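import Mathlib
import HarnessLib
import Summits.NavierStokesRegularity.NavierStokesRegularity.Theorems.PoloidalWindowRigidity.Negative.ResidueFalseWithClassRates
import Literature.Algebra.EuclideanLattices.FccBccLattices

/-!
# Crux `PoloidalWindowRigidity` (K2, stmt-NavierStokesRegularity-19708) — negative side:
# the CRITICAL-STRAIN / CRITICAL-PRODUCTION exclusions are TIGHT WITHOUT the Oseen-mild identity,
# and the drifting witness sits EXACTLY at the critical rate

Negative-side support (refuter seat ns-regularity-refuter1 gen 2, cell ns-regularity-ideate; D-0081 §C), K-read
certificate for `…Theorems.PoloidalWindowDoorPoloidalWindowRigidityCriticalProduction` (p482981, seat nsreg-p7 g5):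

* (A) `nonflatLiouville_of_critical_horizontal_strain`: rate + continuity + (M) + div-free + poloidal +
  «`(−s)⟪Dv(s,y)a, a⟫ ≤ ‖a‖²` for every horizontal `a`» ⇒ not backward-singular;
* (B) `nonflatLiouville_of_critical_production`: rate + continuity + (M) + div-free +
  «`(−s)⟪ω, Dv ω⟫ ≤ |ω|²`» ⇒ not backward-singular.

This file shows, by the drifting discretely self-similar cellular profile `w = driftProfile` of
`…Negative.DriftProfile` (the standing witness of the K2 negative lane):

* `driftProfile_horizontal_strain_le` — `w` satisfies the hypothesis of (A) on EVERY slice: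
  `(−s)⟪Dw(s,y)a, a⟫ = −cos z₂ (sin z₀ a₀² + sin z₁ a₁²) ≤ ‖a‖²` (`z = A_s y`);
* `driftProfile_production_le` — `w` satisfies the hypothesis of (B) (its vorticity is horizontal);
* `driftProfile_critical_strain_attained` — the bound of (A) is ATTAINED (`= ‖a‖²` at `s = −1`,
  `y = (π/2, 0, π)`, `a = e₀`): the witness sits exactly at the critical horizontal strain, so
* `driftProfile_not_supercritical_strain` — it does NOT meet the strict clause
  «`∃ s y a, a ⊥ e₂ ∧ ‖a‖² < (−s)⟪Dv a, a⟫`» announced for skeleton rev 10 (clause (iv′)); and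
* `criticalHorizontalStrain_false_with_classRates_without_mild`,
  `criticalProduction_false_with_classRates_without_mild` — (A) and (B) with the Oseen-mild identity (M)
  REPLACED by the two scale-sharp `ClassRate` bounds (`‖Dv‖ ≤ C₁/(−t)`, `‖curl v‖ ≤ C₂/(−t)`), the frozen
  constraint added for good measure, are FALSE (`C = 4, C₁ = 8, C₂ = 4`; `w` is backward-singular at the apex).
  So (M) is load-bearing in p482981 exactly as in every earlier stratum theorem of the line, and the rev-10
  residue clause (iv′) is the first clause of the line that cuts the amplitude-one witness (not the family:
  an amplitude `μ > 1` restores it, separate certificate).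

WHAT THIS IS NOT: not a claim about Navier–Stokes — kinematics of an explicit profile. [folklore]
-/

noncomputable section

-- the summit and its single sub-problem share the name (CONVENTIONS §1), as in every Theorems file
set_option linter.dupNamespace false

namespace Summit.NavierStokesRegularity.NavierStokesRegularity.Theorems.PoloidalWindowRigidity.Negative

open Set Function
open scoped RealInnerProductSpace InnerProductSpace
open Literature.Analysis Literature.Analysis.FluidPDE

/-! ### A scalar inequality (coordinates of `⟪·,·⟫`, `‖·‖²` on `ℝ³`: `Literature.Algebra.EuclideanLattices.inner_fin_three`, `norm_sq_fin_three`) -/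

/-- `cos p · (−sin q) · w · w ≤ w²`. [folklore] -/
theorem cos_mul_neg_sin_mul_mul_le_sq (p q w : ℝ) : Real.cos p * (-(Real.sin q) * w) * w ≤ w ^ 2 := by
  have h := abs_mul_mul_le_abs (Real.abs_cos_le_one p) (Real.abs_sin_le_one q) (w ^ 2)
  rw [abs_of_nonneg (sq_nonneg w)] at h
  have h2 := neg_abs_le (Real.cos p * (Real.sin q * w ^ 2))
  nlinarith [h, h2]

/-! ### The drifting witness has at most critical horizontal strain, attained -/

/-- **(CS≤) The horizontal strain of the drifting profile never exceeds the critical rate**: for `s < 0`, every `y`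
and every horizontal `a`, `(−s)⟪Dw(s,y) a, a⟫ ≤ ‖a‖²`. [folklore] -/
theorem driftProfile_horizontal_strain_le {s : ℝ} (hs : s < 0) (y a : EuclideanSpace ℝ (Fin 3))
    (ha : ⟪a, EuclideanSpace.single 2 (1 : ℝ)⟫_ℝ = 0) :
    (-s) * ⟪fderiv ℝ (driftProfile s) y a, a⟫_ℝ ≤ ‖a‖ ^ 2 := by
  have ha2 : a 2 = 0 := by
    rw [EuclideanSpace.inner_single_right] at ha
    simpa using ha
  have hsq := cellAmp_sq hs
  have hs' : (-s) * cellAmp s ^ 2 = 1 := by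
    rw [hsq]
    exact mul_inv_cancel₀ (by linarith)
  set z := driftShift s y with hz
  have key : ⟪fderiv ℝ (driftProfile s) y a, a⟫_ℝ = cellAmp s ^ 2 *
      (Real.cos (z 2) * (-(Real.sin (z 0)) * a 0) * a 0 + Real.cos (z 2) * (-(Real.sin (z 1)) * a 1) * a 1) := by
    rw [Literature.Algebra.EuclideanLattices.inner_fin_three, fderiv_driftProfile_apply, fderiv_driftProfile_apply, fderiv_driftProfile_apply,
      cellDeriv_apply_zero, cellDeriv_apply_one, ha2]
    ring
  have h0 := cos_mul_neg_sin_mul_mul_le_sq (z 2) (z 0) (a 0)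
  have h1 := cos_mul_neg_sin_mul_mul_le_sq (z 2) (z 1) (a 1)
  rw [key, ← mul_assoc, hs', one_mul, Literature.Algebra.EuclideanLattices.norm_sq_fin_three, ha2]
  nlinarith [h0, h1]

/-- **(CP≤) The vortex-stretching production of the drifting profile never exceeds the critical rate**:
`(−s)⟪ω, Dw ω⟫ ≤ |ω|²` on every slice (`ω = curl w(s)` is horizontal). [folklore] -/
theorem driftProfile_production_le {s : ℝ} (hs : s < 0) (y : EuclideanSpace ℝ (Fin 3)) :
    (-s) * ⟪curl (driftProfile s) y, fderiv ℝ (driftProfile s) y (curl (driftProfile s) y)⟫_ℝ ≤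
      ⟪curl (driftProfile s) y, curl (driftProfile s) y⟫_ℝ := by
  have h := driftProfile_horizontal_strain_le hs y (curl (driftProfile s) y) (poloidal_driftProfile s y)
  rw [real_inner_comm, real_inner_self_eq_norm_sq]
  exact h

/-- **The critical horizontal strain is ATTAINED** by the drifting profile: at `s = −1`, `y = (π/2, 0, π)`, `a = e₀`
one has `(−s)⟪Dw(s,y)a, a⟫ = 1 = ‖a‖²`. [folklore] -/
theorem driftProfile_critical_strain_attained :
    ∃ s < 0, ∃ (y a : EuclideanSpace ℝ (Fin 3)), ⟪a, EuclideanSpace.single 2 (1 : ℝ)⟫_ℝ = 0 ∧ a ≠ 0 ∧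
      (-s) * ⟪fderiv ℝ (driftProfile s) y a, a⟫_ℝ = ‖a‖ ^ 2 := by
  refine ⟨-1, by norm_num,
    (Real.pi / 2) • EuclideanSpace.single 0 (1 : ℝ) + Real.pi • EuclideanSpace.single 2 (1 : ℝ),
    EuclideanSpace.single 0 (1 : ℝ), ?_, ?_, ?_⟩
  · rw [EuclideanSpace.inner_single_right]; simp
  · intro h
    have h0 := congrArg (fun w : EuclideanSpace ℝ (Fin 3) => w 0) h
    simp at h0
  · have hval : ⟪fderiv ℝ (driftProfile (-1))
        ((Real.pi / 2) • EuclideanSpace.single 0 (1 : ℝ) + Real.pi • EuclideanSpace.single 2 (1 : ℝ))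
        (EuclideanSpace.single 0 (1 : ℝ)), EuclideanSpace.single 0 (1 : ℝ)⟫_ℝ = 1 := by
      rw [EuclideanSpace.inner_single_right]
      simp [fderiv_driftProfile_apply, cellDeriv_apply_zero, driftShift_neg_one, cellAmp]
    rw [hval]
    simp

/-- **The strict (super-critical) strain clause FAILS for the amplitude-one drifting profile**: there is NO slice,
point and horizontal direction with `‖a‖² < (−s)⟪Dw(s,y)a, a⟫` — the clause (iv′) announced for skeleton rev 10
cuts this witness (though not its amplitude-scaled siblings). [folklore] -/
theorem driftProfile_not_supercritical_strain :
    ¬ ∃ s < 0, ∃ (y a : EuclideanSpace ℝ (Fin 3)), ⟪a, EuclideanSpace.single 2 (1 : ℝ)⟫_ℝ = 0 ∧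
      ‖a‖ ^ 2 < (-s) * ⟪fderiv ℝ (driftProfile s) y a, a⟫_ℝ := by
  rintro ⟨s, hs, y, a, ha, hlt⟩
  exact absurd (driftProfile_horizontal_strain_le hs y a ha) (not_le.2 hlt)

/-! ### The certificates: (A) and (B) of p482981 without the Oseen-mild identity are false -/

/-- **(A) without (M) is FALSE.** The hypothesis list of `nonflatLiouville_of_critical_horizontal_strain` — Type-I
rate, joint continuity, divergence-free slices, poloidal along `e₂`, at most critical horizontal strain — with the
Oseen-mild identity REPLACED by the scale-sharp `ClassRate` bounds `‖Dv‖ ≤ C₁/(−t)`, `‖curl v‖ ≤ C₂/(−t)` and the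
frozen constraint ADDED, does not exclude a backward singularity at the apex: the drifting profile
(`C = 4, C₁ = 8, C₂ = 4`). [folklore] -/
theorem criticalHorizontalStrain_false_with_classRates_without_mild :
    ¬ (∀ (C C₁ C₂ : ℝ) (v : ℝ → EuclideanSpace ℝ (Fin 3) → EuclideanSpace ℝ (Fin 3)),
      Literature.Analysis.FluidPDE.HasTypeITimeDecay C v →
      ContinuousOn (Function.uncurry v) (Set.Iio (0 : ℝ) ×ˢ Set.univ) →
      (∀ t < 0, ∀ y, ‖fderiv ℝ (v t) y‖ ≤ C₁ / (-t)) →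
      (∀ t < 0, ∀ y, ‖Literature.Analysis.FluidPDE.curl (v t) y‖ ≤ C₂ / (-t)) →
      (∀ t < 0, Literature.Analysis.FluidPDE.VectorCalculus.IsDivFree (v t)) →
      (∀ s < 0, ∀ y, ⟪Literature.Analysis.FluidPDE.curl (v s) y, EuclideanSpace.single 2 (1 : ℝ)⟫_ℝ = 0) →
      (∀ s < 0, ∀ y, ⟪fderiv ℝ (v s) y (Literature.Analysis.FluidPDE.curl (v s) y), EuclideanSpace.single 2 (1 : ℝ)⟫_ℝ = 0) →
      (∀ s < 0, ∀ (y a : EuclideanSpace ℝ (Fin 3)), ⟪a, EuclideanSpace.single 2 (1 : ℝ)⟫_ℝ = 0 →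
        (-s) * ⟪fderiv ℝ (v s) y a, a⟫_ℝ ≤ ‖a‖ ^ 2) →
      ¬ Literature.Analysis.FluidPDE.IsBackwardSingularPoint v 0) := by
  intro h
  exact h 4 8 4 driftProfile hasTypeITimeDecay_driftProfile continuousOn_driftProfile
    (fun t ht y => norm_fderiv_driftProfile_le ht y) (fun t ht y => norm_curl_driftProfile_le ht y)
    (fun t _ => isDivFree_driftProfile t) (fun s _ y => poloidal_driftProfile s y)
    (fun s _ y => frozen_driftProfile s y)
    (fun s hs y a ha => driftProfile_horizontal_strain_le hs y a ha)
    isBackwardSingularPoint_driftProfile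

/-- **(B) without (M) is FALSE.** The hypothesis list of `nonflatLiouville_of_critical_production` — Type-I rate, joint
continuity, divergence-free slices, at most critical production `(−s)⟪ω, Dv ω⟫ ≤ |ω|²` — with the Oseen-mild identity
REPLACED by the `ClassRate` bounds, and poloidality plus the frozen constraint ADDED, does not exclude a backward
singularity at the apex: the drifting profile (`C = 4, C₁ = 8, C₂ = 4`). [folklore] -/
theorem criticalProduction_false_with_classRates_without_mild :
    ¬ (∀ (C C₁ C₂ : ℝ) (v : ℝ → EuclideanSpace ℝ (Fin 3) → EuclideanSpace ℝ (Fin 3)),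
      Literature.Analysis.FluidPDE.HasTypeITimeDecay C v →
      ContinuousOn (Function.uncurry v) (Set.Iio (0 : ℝ) ×ˢ Set.univ) →
      (∀ t < 0, ∀ y, ‖fderiv ℝ (v t) y‖ ≤ C₁ / (-t)) →
      (∀ t < 0, ∀ y, ‖Literature.Analysis.FluidPDE.curl (v t) y‖ ≤ C₂ / (-t)) →
      (∀ t < 0, Literature.Analysis.FluidPDE.VectorCalculus.IsDivFree (v t)) →
      (∀ s < 0, ∀ y, ⟪Literature.Analysis.FluidPDE.curl (v s) y, EuclideanSpace.single 2 (1 : ℝ)⟫_ℝ = 0) →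
      (∀ s < 0, ∀ y, ⟪fderiv ℝ (v s) y (Literature.Analysis.FluidPDE.curl (v s) y), EuclideanSpace.single 2 (1 : ℝ)⟫_ℝ = 0) →
      (∀ s < 0, ∀ y, (-s) * ⟪Literature.Analysis.FluidPDE.curl (v s) y,
          fderiv ℝ (v s) y (Literature.Analysis.FluidPDE.curl (v s) y)⟫_ℝ ≤
        ⟪Literature.Analysis.FluidPDE.curl (v s) y, Literature.Analysis.FluidPDE.curl (v s) y⟫_ℝ) →
      ¬ Literature.Analysis.FluidPDE.IsBackwardSingularPoint v 0) := by
  intro h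
  exact h 4 8 4 driftProfile hasTypeITimeDecay_driftProfile continuousOn_driftProfile
    (fun t ht y => norm_fderiv_driftProfile_le ht y) (fun t ht y => norm_curl_driftProfile_le ht y)
    (fun t _ => isDivFree_driftProfile t) (fun s _ y => poloidal_driftProfile s y)
    (fun s _ y => frozen_driftProfile s y)
    (fun s hs y => driftProfile_production_le hs y)
    isBackwardSingularPoint_driftProfile

end Summit.NavierStokesRegularity.NavierStokesRegularity.Theorems.PoloidalWindowRigidity.Negative

end
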